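import Summits.BirchSwinnertonDyer.BirchSwinnertonDyer.Theorems.QuadraticBranchSignedControlPlusEtaNonsurjConjADoor
import Summits.BirchSwinnertonDyer.BirchSwinnertonDyer.Theorems.QuadraticBranchSignedControlPlusEtaNonsurjFineRoadConjA
import HarnessLib

/-!
# Route `QuadraticBranchSignedControl` (rung K8, cell `bsd-potss`), residual crux `PlusEtaMainConjectureNonsurj`
# (stmt-BirchSwinnertonDyer-19606): DOOR L6 ∘ FINE ROAD — the INTEGRAL Kato-side inclusion at `η`, and (C1⁺_η) on the
# rank-`0` shape, from ONE class number `p ∤ h(ℚ(P))` (`P ∈ W[p] ∖ 0`, `W` the additive partner) + the analytic `μ`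
# (seat `bsd-potss-k8eta-c2` g20, sequel of `…PlusEtaNonsurjConjADoor`, p690512)

WHAT. Part 1 (`EtaConjADoor`, p690512) gives statement (A) for the partner `W` of a row `V` of crux 19606 from `p ∤ h(ℚ(P))` with
no named fact. k8eta-c2 g6's fine road (`EtaFineRoad.etaUpperIntegral_of_conjA_of_analyticMu`,
`…quadraticBranchPlusEtaMainConjectureAt_of_conjA_of_analyticMu_of_missingLowerBoundAt`, `…_of_hasCM_rankZero`) turns (A)(W,p) + the
analytic `μ(L_p⁺(V,η,X)) = 0` into the INTEGRAL inclusion `(L_p⁺(V,η,X)) ⊆ Char(X⁺(V/K_∞)^η)` on every `η`-frame (Kobayashi Thm. 4.1's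
`pⁿ`-slack removed, image-free), and — with `L(W,1) ≠ 0` and the lower bound `MissingLowerBoundAt W p` (resp. CM) — into (C1⁺_η)(V) itself.
This file composes the two BY NAME:
* `etaUpperIntegral_of_not_dvd_classNumber_of_analyticMu` — `h22 h41 h6273` + `p ∤ h(ℚ(P))` + `μ_an = 0` ⟹ the integral upper inclusion at
  `η` (v5's `stub_etaMC_nonCM_upper` AT THE ROW, with no congruence, no anchor, no preprint binder);
* `quadraticBranchPlusEtaMainConjectureAt_of_not_dvd_classNumber_of_analyticMu_of_missingLowerBoundAt` — rank-`0` shape: + `hPT hmod hGZK hKO`,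
  `L(W,1) ≠ 0`, `MissingLowerBoundAt W p` ⟹ `QuadraticBranchPlusEtaMainConjectureAt V p`;
* `quadraticBranchPlusEtaMainConjectureAt_of_not_dvd_classNumber_of_span_eq_span_X` — prime-`L` rank-`1` shape: `Sel_{p^∞}(W)` infinite,
  `(L_p⁺(V,η,X)) = (X)` ⟹ (C1⁺_η)(V) from the class number ALONE (+ `h22 h41 h6273`);
* `quadraticBranchPlusEtaMainConjectureAt_of_not_dvd_classNumber_of_analyticMu_of_hasCM_rankZero` — CM rank-`0` shape (+ `hS28`).
Census (this seat, kit j323394/j323503, GRH class numbers): `5 ∤ h(ℚ(P))` on 127 of the 188 in-table partner rows at `p = 5` (28/30 non-CM).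

HONEST FRAMING (cell `bsd-potss`; FULL-BSD rank ≤ 1 programme, HUMAN RULING D-0036/D-0074): COMPOSITIONS ONLY — no definition, no named fact
minted, no `sorry`, axioms standard; CONDITIONAL on the displayed named facts (`h22`, `h41`, `h6273`; `hPT`, `hmod`, `hGZK`, `hKO`, `hS28`) and
the displayed per-row inputs (ONE class number — a GRH numeric in the census —, the analytic `μ`, `L(W,1) ≠ 0`, the lower bound). No stub of
19606 is proved by name; the crux stays OPEN; nothing is booked; `BSD(W,p)` is claimed for no pair. `--supports stmt-BirchSwinnertonDyer-19606`.

References: [Kobayashi2003] §4 and Thm. 4.1 (p. 8), Thm. 2.2, Thm. 7.3 i) (7.21); [CoatesSujatha2005] §3 (A), Thm. 3.4; [DeoRaySujatha2023] Thm. 3.8;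
[GreenbergVatsal2000] p. 2 (2); [Miller2011LMS] Def. 1.1; [BurungaleFlach2024] Thm. 1.1.
-/

set_option autoImplicit false
-- sibling precedent (`KatoDescentPotSupersingularAssembly.lean`): the directory name repeats the summit name
set_option linter.dupNamespace false
noncomputable section

open scoped Classical

open CongruenceSubgroup NumberField Field WeierstrassCurve
open Literature.NumberTheory.EllipticCurves Literature.NumberTheory.EllipticCurves.ModularForms
  Literature.NumberTheory.EllipticCurves.Rank1Residual Literature.NumberTheory.EllipticCurves.Rank1Residual.Typed
  Literature.NumberTheory.GaloisRepresentations Literature.NumberTheory.GaloisCohomology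
  Literature.NumberTheory.EllipticCurves.GreenbergVatsal2000 ZpExtension
open Summit.BirchSwinnertonDyer.Rank1Residual.Additive

namespace Summit.BirchSwinnertonDyer.BirchSwinnertonDyer.Theorems.EtaConjADoor

variable (V : WeierstrassCurve ℚ) [V.IsElliptic] [V.IsGloballyMinimal] (W : WeierstrassCurve ℚ) [W.IsElliptic]
  [W.IsGloballyMinimal] (C : VariableChange ℚ) (p : ℕ) [hp : Fact p.Prime]

omit [W.IsGloballyMinimal] in
/-- **The INTEGRAL Kato-side inclusion at `η` on a row from ONE class number and the analytic `μ`.** For a row `V` of crux 19606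
(`p ≥ 5` good, `a_p = 0`, tower not onto) with additive partner `W` (`C • W^{(p*)} = V`, globally minimal): `h22 h41 h6273` + some
`P ∈ W[p] ∖ 0` with `p ∤ h(ℚ(P))` + `μ(L_p⁺(V,η,X)) = 0` for every period-normalised choice ⟹ on every `η`-frame and every dual datum `D`,
`(Lη) ⊆ Char(D.X)` — door L6 (`conjA_partner_of_not_dvd_classNumber_stabilizerField`) fed to the fine road
(`EtaFineRoad.etaUpperIntegral_of_conjA_of_analyticMu`). CONDITIONAL; nothing booked.
[cite: Kobayashi2003, Thm. 4.1 first display (p. 8), Thm. 2.2 (p. 5), Thm. 7.3 i) (7.21) (p. 13)] [cite: CoatesSujatha2005, §3 (A) and Thm. 3.4] -/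
theorem etaUpperIntegral_of_not_dvd_classNumber_of_analyticMu
    (h22 : Kobayashi2003.thm22_etaSignedSelmerDual_finite_torsion)
    (h41 : Kobayashi2003.thm41_plusEtaCharIdeal_dvd)
    (h6273 : Kobayashi2003.thm62_63_73_etaColemanPoitouTate)
    [NeZero p] (hp5 : 5 ≤ p) (hC : C • W.quadraticTwist ((-1) ^ (p / 2) * p) = V)
    (hgood : V.HasGoodReductionAtPrime p) (hap : V.frobeniusTrace p = 0)
    (hns : ¬ ∀ m : ℕ, V.HasSurjectiveModNGaloisRep (p ^ m : ℕ))
    (hP : haveI : NumberField (W.divisionField p) := NumberField.mk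
      ∃ P : geomTorsion W (p : ℤ), P ≠ 0 ∧
        ¬ p ∣ NumberField.classNumber (IntermediateField.fixedField
          ((MulAction.stabilizer (absoluteGaloisGroup ℚ) P).map (absRestrictNormalHom (W.divisionField p)))))
    (hμan : ∀ {N : ℕ} [NeZero N] {f : CuspForm (Gamma0 N) 2}, IsNewformOf V f →
      ∀ (ϖ : ℚ), (if Even (p / 2) then (ϖ : ℝ) * V.realPeriodRat = plusPeriod f
          else (ϖ : ℝ) * V.imaginaryPeriodRat = minusPeriod f) →
      ∀ (Lη : IwasawaAlgebra p), IsQuadraticBranchPlusLFunction f p ϖ Lη → HasUnitContent Lη) :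
    ∀ (K₀ : Type) [Field K₀] [NumberField K₀] [IsCyclotomicExtension {p} ℚ K₀]
        [(galRange (K := ℚ) K₀).Normal] (ηq : absoluteGaloisGroup ℚ →* ℤˣ),
        (∀ σ ∈ galRange (K := ℚ) K₀, ηq σ = 1) → ηq ≠ 1 →
      ∀ {N : ℕ} [NeZero N] {f : CuspForm (Gamma0 N) 2},
        p ≠ 2 → V.HasGoodReductionAtPrime p → V.frobeniusTrace p = 0 → IsNewformOf V f →
      ∀ (ϖ : ℚ), (if Even (p / 2) then (ϖ : ℝ) * V.realPeriodRat = plusPeriod f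
          else (ϖ : ℝ) * V.imaginaryPeriodRat = minusPeriod f) →
      ∀ (Lη : IwasawaAlgebra p), IsQuadraticBranchPlusLFunction f p ϖ Lη →
      ∀ (κ : ZpExtension ℚ p) (γ : absoluteGaloisGroup ℚ),
        κ.IsCyclotomic → κ.IsTopGenerator γ → γ ∈ galRange (K := ℚ) K₀ → IsCyclotomicVariable p γ →
      ∀ (D : EtaSignedSelmerDualData V κ K₀ ℚ_[p] ηq γ 1), Ideal.span {Lη} ≤ D.charIdeal :=
  EtaFineRoad.etaUpperIntegral_of_conjA_of_analyticMu W p h22 h41 h6273 V C hC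
    (conjA_partner_of_not_dvd_classNumber_stabilizerField V p W C hp5 hC hgood hap hns hP) hμan

/-- **Rank-`0` shape: (C1⁺_η)(V) from ONE class number, the analytic `μ`, `L(W,1) ≠ 0` and the lower bound `L₀(W,p)`** — door L6 fed to
`EtaFineRoad.quadraticBranchPlusEtaMainConjectureAt_of_conjA_of_analyticMu_of_missingLowerBoundAt` (ctrl g4's converse control road).
Named facts `hPT hmod hGZK h22 h41 hKO h6273`; displayed per-row inputs: the class number, `μ_an`, `L(W,1) ≠ 0`, `MissingLowerBoundAt W p`.
CONDITIONAL; nothing booked. [cite: Kobayashi2003, §4 Even main conjecture and Thm. 4.1 (p. 8), Thm. 7.3 i) (p. 13)]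
[cite: CoatesSujatha2005, §3 statement (A)] [cite: Miller2011LMS, Def. 1.1] -/
theorem quadraticBranchPlusEtaMainConjectureAt_of_not_dvd_classNumber_of_analyticMu_of_missingLowerBoundAt
    (hPT : poitouTate_selmerStructure_duality_real ℚ) (hmod : hasEntireLFunction_rat)
    (hGZK : rank_eq_analyticRank_of_analyticRank_le_one)
    (h22 : Kobayashi2003.thm22_etaSignedSelmerDual_finite_torsion)
    (h41 : Kobayashi2003.thm41_plusEtaCharIdeal_dvd)
    (hKO : KitajimaOtsuki2018.mainThm13_etaSignedSelmerDual_noFiniteSubmodule)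
    (h6273 : Kobayashi2003.thm62_63_73_etaColemanPoitouTate)
    [NeZero p] (hp5 : 5 ≤ p) (hC : C • W.quadraticTwist ((-1) ^ (p / 2) * p) = V)
    (hgood : V.HasGoodReductionAtPrime p) (hap : V.frobeniusTrace p = 0)
    (hns : ¬ ∀ m : ℕ, V.HasSurjectiveModNGaloisRep (p ^ m : ℕ))
    (hP : haveI : NumberField (W.divisionField p) := NumberField.mk
      ∃ P : geomTorsion W (p : ℤ), P ≠ 0 ∧
        ¬ p ∣ NumberField.classNumber (IntermediateField.fixedField
          ((MulAction.stabilizer (absoluteGaloisGroup ℚ) P).map (absRestrictNormalHom (W.divisionField p)))))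
    (hμan : ∀ {N : ℕ} [NeZero N] {f : CuspForm (Gamma0 N) 2}, IsNewformOf V f →
      ∀ (ϖ : ℚ), (if Even (p / 2) then (ϖ : ℝ) * V.realPeriodRat = plusPeriod f
          else (ϖ : ℝ) * V.imaginaryPeriodRat = minusPeriod f) →
      ∀ (Lη : IwasawaAlgebra p), IsQuadraticBranchPlusLFunction f p ϖ Lη → HasUnitContent Lη)
    (hLW : W.entireLFunction 1 ≠ 0) (hlow : MissingLowerBoundAt W p) :
    QuadraticBranchPlusEtaMainConjectureAt V p :=
  EtaFineRoad.quadraticBranchPlusEtaMainConjectureAt_of_conjA_of_analyticMu_of_missingLowerBoundAt W p hPT hmod hGZK h22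
    h41 hKO h6273 V C hp5 hC hgood hap
    (conjA_partner_of_not_dvd_classNumber_stabilizerField V p W C hp5 hC hgood hap hns hP) hμan hLW hlow

omit [W.IsGloballyMinimal] in
/-- **Prime-`L` rank-`1` shape: (C1⁺_η)(V) from ONE class number ALONE** (granted `h22 h41 h6273`): `Sel_{p^∞}(W/ℚ)` infinite and
`(L_p⁺(V,η,X)) = (X)` (displayed analytic input; the analytic `μ` is then automatic) + some `P ∈ W[p] ∖ 0` with `p ∤ h(ℚ(P))` ⟹
`QuadraticBranchPlusEtaMainConjectureAt V p` — door L6 fed to `EtaFineRoad.quadraticBranchPlusEtaMainConjectureAt_of_span_eq_span_X_of_conjA`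
(g6's fine form of g4's prime-`L` road). CONDITIONAL; nothing booked.
[cite: Kobayashi2003, §4 Even main conjecture and Thm. 4.1 first display (p. 8), Thm. 7.3 i) (p. 13)] [cite: CoatesSujatha2005, §3 statement (A)]
[cite: GreenbergLNM1716, §4 Lemma 4.2 (p. 102)] -/
theorem quadraticBranchPlusEtaMainConjectureAt_of_not_dvd_classNumber_of_span_eq_span_X
    (h22 : Kobayashi2003.thm22_etaSignedSelmerDual_finite_torsion)
    (h41 : Kobayashi2003.thm41_plusEtaCharIdeal_dvd)
    (h6273 : Kobayashi2003.thm62_63_73_etaColemanPoitouTate)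
    [NeZero p] (hp5 : 5 ≤ p) (hC : C • W.quadraticTwist ((-1) ^ (p / 2) * p) = V)
    (hgood : V.HasGoodReductionAtPrime p) (hap : V.frobeniusTrace p = 0)
    (hns : ¬ ∀ m : ℕ, V.HasSurjectiveModNGaloisRep (p ^ m : ℕ))
    (hinf : ¬ Finite ↥(W.selmerGroupPInfty p))
    (hX : ∀ {N : ℕ} [NeZero N] {f : CuspForm (Gamma0 N) 2}, IsNewformOf V f →
      ∀ (ϖ : ℚ), (if Even (p / 2) then (ϖ : ℝ) * V.realPeriodRat = plusPeriod f
          else (ϖ : ℝ) * V.imaginaryPeriodRat = minusPeriod f) →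
      ∀ (Lη : IwasawaAlgebra p), IsQuadraticBranchPlusLFunction f p ϖ Lη →
        Ideal.span {Lη} = Ideal.span {(PowerSeries.X : IwasawaAlgebra p)})
    (hP : haveI : NumberField (W.divisionField p) := NumberField.mk
      ∃ P : geomTorsion W (p : ℤ), P ≠ 0 ∧
        ¬ p ∣ NumberField.classNumber (IntermediateField.fixedField
          ((MulAction.stabilizer (absoluteGaloisGroup ℚ) P).map (absRestrictNormalHom (W.divisionField p))))) :
    QuadraticBranchPlusEtaMainConjectureAt V p :=
  EtaFineRoad.quadraticBranchPlusEtaMainConjectureAt_of_span_eq_span_X_of_conjA W p h22 h41 h6273 V C hp5 hC hgood hap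
    hinf hX (conjA_partner_of_not_dvd_classNumber_stabilizerField V p W C hp5 hC hgood hap hns hP)

/-- **CM rank-`0` shape: (C1⁺_η)(V) from ONE class number, the analytic `μ` and `L(W,1) ≠ 0`** (the lower half is bsd.S28 through ctrl g4's
road) — door L6 fed to `EtaFineRoad.quadraticBranchPlusEtaMainConjectureAt_of_conjA_of_analyticMu_of_hasCM_rankZero`. Named facts
`hPT hmod hGZK h22 h41 hKO hS28 h6273`. CONDITIONAL; nothing booked. [cite: Kobayashi2003, §4 Even main conjecture and Thm. 4.1 (p. 8)]
[cite: BurungaleFlach2024, Thm 1.1 and Cor. 2] [cite: CoatesSujatha2005, §3 statement (A)] -/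
theorem quadraticBranchPlusEtaMainConjectureAt_of_not_dvd_classNumber_of_analyticMu_of_hasCM_rankZero
    (hPT : poitouTate_selmerStructure_duality_real ℚ) (hmod : hasEntireLFunction_rat)
    (hGZK : rank_eq_analyticRank_of_analyticRank_le_one)
    (h22 : Kobayashi2003.thm22_etaSignedSelmerDual_finite_torsion)
    (h41 : Kobayashi2003.thm41_plusEtaCharIdeal_dvd)
    (hKO : KitajimaOtsuki2018.mainThm13_etaSignedSelmerDual_noFiniteSubmodule)
    (hS28 : bsdTriple_of_hasCM_of_L_one_ne_zero)
    (h6273 : Kobayashi2003.thm62_63_73_etaColemanPoitouTate)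
    [NeZero p] (hp5 : 5 ≤ p) (hC : C • W.quadraticTwist ((-1) ^ (p / 2) * p) = V)
    (hgood : V.HasGoodReductionAtPrime p) (hap : V.frobeniusTrace p = 0)
    (hns : ¬ ∀ m : ℕ, V.HasSurjectiveModNGaloisRep (p ^ m : ℕ)) (hCM : V.HasCM)
    (hP : haveI : NumberField (W.divisionField p) := NumberField.mk
      ∃ P : geomTorsion W (p : ℤ), P ≠ 0 ∧
        ¬ p ∣ NumberField.classNumber (IntermediateField.fixedField
          ((MulAction.stabilizer (absoluteGaloisGroup ℚ) P).map (absRestrictNormalHom (W.divisionField p)))))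
    (hμan : ∀ {N : ℕ} [NeZero N] {f : CuspForm (Gamma0 N) 2}, IsNewformOf V f →
      ∀ (ϖ : ℚ), (if Even (p / 2) then (ϖ : ℝ) * V.realPeriodRat = plusPeriod f
          else (ϖ : ℝ) * V.imaginaryPeriodRat = minusPeriod f) →
      ∀ (Lη : IwasawaAlgebra p), IsQuadraticBranchPlusLFunction f p ϖ Lη → HasUnitContent Lη)
    (hLW : W.entireLFunction 1 ≠ 0) :
    QuadraticBranchPlusEtaMainConjectureAt V p :=
  EtaFineRoad.quadraticBranchPlusEtaMainConjectureAt_of_conjA_of_analyticMu_of_hasCM_rankZero W p hPT hmod hGZK h22 h41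
    hKO hS28 h6273 V C hp5 hC hgood hap hCM
    (conjA_partner_of_not_dvd_classNumber_stabilizerField V p W C hp5 hC hgood hap hns hP) hμan hLW

end Summit.BirchSwinnertonDyer.BirchSwinnertonDyer.Theorems.EtaConjADoor

end
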